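import Summits.ValiantsHypothesis.ValiantsHypothesis.Theorems.BarrierLeverAnchoredDoorHitsLowerPairsStarCofactor
import Summits.ValiantsHypothesis.ValiantsHypothesis.Theorems.BarrierLeverAnchoredDoorHitsLowerPairsStarArrow

/-!
# Route BarrierLever — support item `AnchoredDoorHitsLowerPairs` (stmt-ValiantsHypothesis-22510), line `anchored_peeling`:
# STAR-MATRIX CERTIFICATES AT THE DOOR LEVEL (val-np-p1 g31)

The item's residual nodes are phrased in `symbolicDet 2 h r u w ≠ 0` / `AnchoredHit 2 h r u w`. This file composes the three star-matrix
certificate classes of this generation with the landed bridge `StarDoor.symbolicDet_two_ne_zero_of_starDet` (…StarArrow, p727740), so that each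
of them is usable where the line's registry lives:
* `symbolicDet_two_ne_zero_of_cofactor` / `anchoredHit_two_of_cofactor` — the VERTEX–FACET COFACTOR certificate (…StarCofactor, p738680):
  one vertex row `{b}`, one ⊆-maximal nonempty column `T`, and a nonzero `(T, {b})`-cofactor of SOME pure evaluation matrix;
* `symbolicDet_two_ne_zero_of_starPivot` — the BALANCED VERTEX PIVOT (…StarPivot, p737417) read at the door level;
* `anchoredHit_two_of_evalDet` — the evaluation face (…StarFaces, p735242) at profile 2 (profile ≥ 1 was already `symbolicDet_ne_zero_of_evalDet`).
CENSUS of record (memo HOME/val-np-p1/g31/MEMO-trop-valnp1-g31.md §11b): evaluation faces + vertex–facet cofactor certify, given one numeric `θ` per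
pair, every lower pair on ≤ 5+5 vertices and 159/160 random crossing pairs on 6–7 vertices. This file does NOT prove `Stmt.conjStarLower`;
nothing here bears on crux 14610 or on `VP ≠ VNP`.
-/

set_option linter.dupNamespace false

namespace Summit.ValiantsHypothesis.ValiantsHypothesis.Theorems.BarrierLever.AnchoredPeeling

open Finset

noncomputable section

namespace StarDoor

variable {h r : ℕ}

/-- **Vertex–facet cofactor ⟹ `symbolicDet 2 ≠ 0`.** For an injective LOWER pair `(u, w)`: if the rows contain the vertex `{b}` (at `i₀`), the
column `T = w j₀` is nonempty and ⊆-maximal among the columns, and for some `θ` the `(j₀, i₀)` adjugate entry of the pure evaluation matrix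
`(∏_{b' ∈ u i} Σ_{e ∈ w j} θ_{b'e})` is nonzero, then the profile-2 anchored door has a nonzero symbolic partition minor on `(u, w)`. -/
theorem symbolicDet_two_ne_zero_of_cofactor (u w : Fin r → Finset (Fin h)) (hu : Function.Injective u) (hw : Function.Injective w)
    (hlu : IsLowerSet (Set.range u)) (hlw : IsLowerSet (Set.range w)) (b : Fin h) (i₀ j₀ : Fin r) (hb : u i₀ = {b})
    (hT : (w j₀).Nonempty) (hmax : ∀ j, w j₀ ⊆ w j → w j = w j₀)
    (hcof : ∃ θ : Fin h → Fin h → ℂ, (Matrix.of fun i j : Fin r => ∏ b' ∈ u i, ∑ e ∈ w j, θ b' e).adjugate j₀ i₀ ≠ 0) :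
    symbolicDet 2 h r u w ≠ 0 := by
  have hu0 : ∀ i, u i = {b} ↔ i = i₀ := fun i =>
    ⟨fun hi => hu (hi.trans hb.symm), fun hi => by rw [hi]; exact hb⟩
  have hw0 : ∀ j, w j = w j₀ ↔ j = j₀ := fun j => ⟨fun hj => hw hj, fun hj => by rw [hj]⟩
  obtain ⟨g, d, hdet⟩ := starDet_ne_zero_of_cofactor u w b (w j₀) i₀ j₀ hu0 hw0 hT hmax hcof
  exact symbolicDet_two_ne_zero_of_starDet g d u w hu hw hlu hlw hdet

/-- **Vertex–facet cofactor ⟹ an anchored hit of profile 2** (`stub_genericPoint`). -/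
theorem anchoredHit_two_of_cofactor (u w : Fin r → Finset (Fin h)) (hu : Function.Injective u) (hw : Function.Injective w)
    (hlu : IsLowerSet (Set.range u)) (hlw : IsLowerSet (Set.range w)) (b : Fin h) (i₀ j₀ : Fin r) (hb : u i₀ = {b})
    (hT : (w j₀).Nonempty) (hmax : ∀ j, w j₀ ⊆ w j → w j = w j₀)
    (hcof : ∃ θ : Fin h → Fin h → ℂ, (Matrix.of fun i j : Fin r => ∏ b' ∈ u i, ∑ e ∈ w j, θ b' e).adjugate j₀ i₀ ≠ 0) :
    AnchoredHit 2 h r u w :=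
  stub_genericPoint 2 h r u w (symbolicDet_two_ne_zero_of_cofactor u w hu hw hlu hlw b i₀ j₀ hb hT hmax hcof)

/-- **The balanced vertex pivot at the door level:** for an injective lower pair and a permutation `σ` matching the columns through `e₀` with
the rows through `b₀`, nonsingular star blocks for the link pair and the deletion pair give `symbolicDet 2 h r u w ≠ 0`. -/
theorem symbolicDet_two_ne_zero_of_starPivot (u w : Fin r → Finset (Fin h)) (hu : Function.Injective u) (hw : Function.Injective w)
    (hlu : IsLowerSet (Set.range u)) (hlw : IsLowerSet (Set.range w)) (b₀ e₀ : Fin h) (σ : Equiv.Perm (Fin r))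
    (hσ : ∀ j, e₀ ∈ w (σ j) ↔ b₀ ∈ u j)
    (Hlk : ∃ g d : Fin h → Fin h → ℂ,
      (Matrix.of fun i j : {i : Fin r // b₀ ∈ u i} => starEntry g d ((u i).erase b₀) ((w (σ j)).erase e₀)).det ≠ 0)
    (Hdl : ∃ g d : Fin h → Fin h → ℂ,
      (Matrix.of fun i j : {i : Fin r // b₀ ∉ u i} => starEntry g d (u i) (w (σ j))).det ≠ 0) :
    symbolicDet 2 h r u w ≠ 0 := by
  obtain ⟨g, d, hdet⟩ := starDet_ne_zero_of_pivot u w b₀ e₀ hlu hlw σ hσ Hlk Hdl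
  exact symbolicDet_two_ne_zero_of_starDet g d u w hu hw hlu hlw hdet

/-- **The evaluation face at profile 2 as an anchored hit** (for an injective lower pair): a nonsingular evaluation matrix gives
`AnchoredHit 2 h r u w` — via the star matrix (…StarFaces) rather than via the profile-1 door. -/
theorem anchoredHit_two_of_evalDet (u w : Fin r → Finset (Fin h)) (hu : Function.Injective u) (hw : Function.Injective w)
    (hlu : IsLowerSet (Set.range u)) (hlw : IsLowerSet (Set.range w))
    (hE : ∃ θ : Fin h → Fin h → ℂ, (Matrix.of fun i j : Fin r => ∏ b' ∈ u i, ∑ γ ∈ w j, θ b' γ).det ≠ 0) :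
    AnchoredHit 2 h r u w := by
  obtain ⟨g, d, hdet⟩ := starDet_ne_zero_of_evalDet u w hE
  exact stub_genericPoint 2 h r u w (symbolicDet_two_ne_zero_of_starDet g d u w hu hw hlu hlw hdet)

end StarDoor

end

end Summit.ValiantsHypothesis.ValiantsHypothesis.Theorems.BarrierLever.AnchoredPeeling
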